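import Literature.Geometry.Riemannian.CurveTubeMap
import Literature.Geometry.Riemannian.NormalExpTubular
import Literature.Geometry.Manifold.InverseFunctionTheoremVectorSpace
import HarnessLib

/-!
# The tube map of a framed curve is an embedding of a uniform tube (Lee 2018, Thm. 5.25)

Topic `Geometry/Riemannian`. Continuing `CurveTubeMap.lean`: the tube map
`Φ(v) = exp_{c(ℓ v)}(e(ℓ v)(v - (ℓ v) ε₀))` of a curve `c` with an adapted frame `e`
(`e t ε₀ = c'(t)`, `e t` injective, `dim V = dim M`) over a geodesically complete `C^∞` covariant
derivative has, on the axis, the injective differential `dΦ_{x₁ε₀} = e(x₁)`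
(`mfderiv_tubeMap_axis_apply`); by the inverse function theorem it is a local diffeomorphism at
the points of the axis, and if `c` is injective on `[a, b]` then — exactly as in the printed proof
of the tubular neighbourhood theorem (Lee 2018, Thm. 5.25: "an injective local diffeomorphism …
if `P` is compact, `U` contains a uniform tubular neighborhood") — `Φ` is injective and a local
diffeomorphism on a uniform solid tube `{ℓ v ∈ [a, b], ‖v - (ℓ v)ε₀‖ < r}` around the compact axis
segment:

* `isLocalDiffeomorphAt_tubeMap_axis` — `Φ` is a `C^∞` local diffeomorphism at `x₁ ε₀`;
* `exists_tube_injOn_tubeMap` — **the uniform tube**: `∃ r > 0`, `Φ` injective on the tube and a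
  local diffeomorphism at each of its points (`exists_isOpen_injOn_of_isCompact`,
  `IsCompact.exists_thickening_subset_open`).

This is the embedding of Weinstein's disk `D = Φ(B)`, `B` a thin ellipsoid around the axis
(Weinstein 1968, proof of the main theorem, step (2)).

## References

* J. M. Lee, *Introduction to Riemannian Manifolds*, 2nd ed., Springer GTM 176 (2018), Thm. 5.25
  and its proof, pp. 133–134. [cite: LeeRiemannianManifolds2018, Thm. 5.25]
* A. Weinstein, Ann. of Math. (2) 87 (1968), 29–41. [cite: Weinstein1968]

Tags: [TubularNeighbourhood] [FermiCoordinates] [Weinstein1968]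
-/

noncomputable section

open Bundle Set Filter Function Metric Module
open scoped Manifold ContDiff Topology RealInnerProductSpace

namespace Literature.Geometry.Riemannian

open Literature.Geometry.Lorentzian Literature.Geometry.Manifold Literature.Topology.FourManifolds

variable {V : Type*} [NormedAddCommGroup V] [InnerProductSpace ℝ V] [FiniteDimensional ℝ V]
  {E : Type*} [NormedAddCommGroup E] [NormedSpace ℝ E] {H : Type*} [TopologicalSpace H]
  {I : ModelWithCorners ℝ E H} {M : Type*} [TopologicalSpace M] [ChartedSpace H M]
  [IsManifold I ∞ M] [FiniteDimensional ℝ E] [CompleteSpace E] [T2Space M] [BoundarylessManifold I M]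
  {cov : CovariantDerivative I E (TangentSpace I : M → Type _)}
  [CovariantDerivative.ContMDiffCovariantDerivative cov 1]
  [CovariantDerivative.ContMDiffCovariantDerivative cov ((⊤ : ℕ∞) : ℕ∞ω)]
  {c : ℝ → M} {e : Π t : ℝ, V →L[ℝ] TangentSpace I (c t)} {ε₀ : V}

/-- **The tube map is a local diffeomorphism at the points of the axis** (inverse function
theorem, `isLocalDiffeomorphAt_of_mfderiv_of_normedSpace`): `dΦ_{x₁ε₀} = e(x₁)` is injective and
`dim V = dim M`. [cite: LeeRiemannianManifolds2018, Thm. 5.25 (proof, first paragraph)] -/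
theorem isLocalDiffeomorphAt_tubeMap_axis (hc : IsGeodesicallyComplete cov)
    (hs : ContMDiff (𝓘(ℝ, ℝ).prod 𝓘(ℝ, V)) I.tangent ∞
      (fun q : ℝ × V ↦ (TotalSpace.mk' E (c q.1) (e q.1 q.2) : TangentBundle I M)))
    (hε₀ : ‖ε₀‖ = 1) (he₀ : ∀ t, e t ε₀ = (velocity I c t : E))
    (heinj : ∀ t, Injective (e t)) (hdim : finrank ℝ V = finrank ℝ E) (x₁ : ℝ) :
    IsLocalDiffeomorphAt 𝓘(ℝ, V) I ∞
      (fun v : V ↦ expMap cov (c ⟪ε₀, v⟫) (e ⟪ε₀, v⟫ (v - ⟪ε₀, v⟫ • ε₀))) (x₁ • ε₀) := by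
  haveI : CompleteSpace V := FiniteDimensional.complete ℝ V
  set Φ : V → M := fun v : V ↦ expMap cov (c ⟪ε₀, v⟫) (e ⟪ε₀, v⟫ (v - ⟪ε₀, v⟫ • ε₀)) with hΦ
  have hΦs : ContMDiff 𝓘(ℝ, V) I ∞ Φ := contMDiff_tubeMap (cov := cov) hc hs
  set A : V →L[ℝ] E := mfderiv 𝓘(ℝ, V) I Φ (x₁ • ε₀) with hA
  have hAe : ∀ w : V, A w = e x₁ w := fun w ↦
    mfderiv_tubeMap_axis_apply (cov := cov) hc hs hε₀ he₀ x₁ w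
  have hAinj : Injective A := by
    intro u w h
    have h' : e x₁ u = e x₁ w := by rw [← hAe, ← hAe]; exact h
    exact heinj x₁ h'
  set f' : V ≃L[ℝ] E :=
    (LinearMap.linearEquivOfInjective (A : V →ₗ[ℝ] E) hAinj hdim).toContinuousLinearEquiv with hf'
  have hcoe : mfderiv 𝓘(ℝ, V) I Φ (x₁ • ε₀) = (f' : V →L[ℝ] E) := by
    ext w
    rfl
  have hn : ((⊤ : ℕ∞) : ℕ∞ω) ≠ 0 := by simp
  exact isLocalDiffeomorphAt_of_mfderiv_of_normedSpace (I := I) (n := ∞) (f := Φ) hn isOpen_univ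
    (mem_univ _) hΦs.contMDiffOn f' hcoe

/-- **A uniform tube on which the tube map is an injective local diffeomorphism** (Lee 2018,
proof of Thm. 5.25 for a compact piece of the submanifold): if moreover `c` is injective on
`[a, b]`, there is `r > 0` such that on the solid tube `{ℓ v ∈ [a, b], ‖v - (ℓ v)ε₀‖ < r}` the map
`Φ` is injective and a `C^∞` local diffeomorphism at every point. Ingredients: local
diffeomorphism on the axis (`isLocalDiffeomorphAt_tubeMap_axis`) hence near it
(`eventually_isLocalDiffeomorphAt`); injective on the compact axis segment (`Φ(x₁ε₀) = c x₁`) and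
locally injective, hence injective on a neighbourhood (`exists_isOpen_injOn_of_isCompact`); a
uniform thickening inside the neighbourhood (`IsCompact.exists_thickening_subset_open`).
[cite: LeeRiemannianManifolds2018, Thm. 5.25 (proof)] -/
theorem exists_tube_injOn_tubeMap (hc : IsGeodesicallyComplete cov)
    (hs : ContMDiff (𝓘(ℝ, ℝ).prod 𝓘(ℝ, V)) I.tangent ∞
      (fun q : ℝ × V ↦ (TotalSpace.mk' E (c q.1) (e q.1 q.2) : TangentBundle I M)))
    (hε₀ : ‖ε₀‖ = 1) (he₀ : ∀ t, e t ε₀ = (velocity I c t : E))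
    (heinj : ∀ t, Injective (e t)) (hdim : finrank ℝ V = finrank ℝ E)
    {a b : ℝ} (hcinj : InjOn c (Icc a b)) :
    ∃ r : ℝ, 0 < r ∧
      InjOn (fun v : V ↦ expMap cov (c ⟪ε₀, v⟫) (e ⟪ε₀, v⟫ (v - ⟪ε₀, v⟫ • ε₀)))
        {v : V | ⟪ε₀, v⟫ ∈ Icc a b ∧ ‖v - ⟪ε₀, v⟫ • ε₀‖ < r} ∧
      ∀ v : V, ⟪ε₀, v⟫ ∈ Icc a b → ‖v - ⟪ε₀, v⟫ • ε₀‖ < r →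
        IsLocalDiffeomorphAt 𝓘(ℝ, V) I ∞
          (fun v : V ↦ expMap cov (c ⟪ε₀, v⟫) (e ⟪ε₀, v⟫ (v - ⟪ε₀, v⟫ • ε₀))) v := by
  set Φ : V → M := fun v : V ↦ expMap cov (c ⟪ε₀, v⟫) (e ⟪ε₀, v⟫ (v - ⟪ε₀, v⟫ • ε₀)) with hΦ
  have hΦs : ContMDiff 𝓘(ℝ, V) I ∞ Φ := contMDiff_tubeMap (cov := cov) hc hs
  have hax : ∀ x₁ : ℝ, Φ (x₁ • ε₀) = c x₁ := fun x₁ ↦ tubeMap_axis (cov := cov) (e := e) hε₀ x₁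
  have hloc0 : ∀ x₁ : ℝ, IsLocalDiffeomorphAt 𝓘(ℝ, V) I ∞ Φ (x₁ • ε₀) := fun x₁ ↦
    isLocalDiffeomorphAt_tubeMap_axis (cov := cov) hc hs hε₀ he₀ heinj hdim x₁
  -- the open set of points at which `Φ` is a local diffeomorphism
  set L : Set V := {v | IsLocalDiffeomorphAt 𝓘(ℝ, V) I ∞ Φ v} with hL
  have hLo : IsOpen L := isOpen_iff_mem_nhds.2 fun v hv ↦ eventually_isLocalDiffeomorphAt hv
  -- the compact axis segment
  set K : Set V := (fun x₁ : ℝ ↦ x₁ • ε₀) '' Icc a b with hK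
  have hKc : IsCompact K := isCompact_Icc.image (continuous_id.smul continuous_const)
  -- injectivity on a neighbourhood of the axis segment
  obtain ⟨V₁, hV₁o, hKV₁, hinjV₁⟩ : ∃ V₁ : Set V, IsOpen V₁ ∧ K ⊆ V₁ ∧ InjOn Φ V₁ := by
    refine exists_isOpen_injOn_of_isCompact hKc (fun v _ ↦ (hΦs v).continuousAt) ?_ ?_
    · rintro _ ⟨s, hs', rfl⟩ _ ⟨t, ht', rfl⟩ h
      have h' : c s = c t := by rw [← hax s, ← hax t]; exact h
      rw [hcinj hs' ht' h']
    · rintro _ ⟨s, -, rfl⟩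
      exact exists_injOn_nhds_of_isLocalDiffeomorphAt (hloc0 s)
  -- a uniform thickening of the axis segment inside `V₁ ∩ L`
  have hKO : K ⊆ V₁ ∩ L := by
    rintro _ ⟨s, hs', rfl⟩
    exact ⟨hKV₁ ⟨s, hs', rfl⟩, hloc0 s⟩
  obtain ⟨r, hr, hthick⟩ := hKc.exists_thickening_subset_open (hV₁o.inter hLo) hKO
  have hmem : ∀ v : V, ⟪ε₀, v⟫ ∈ Icc a b → ‖v - ⟪ε₀, v⟫ • ε₀‖ < r → v ∈ V₁ ∩ L := by
    intro v hv hvr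
    apply hthick
    rw [mem_thickening_iff]
    exact ⟨⟪ε₀, v⟫ • ε₀, ⟨⟪ε₀, v⟫, hv, rfl⟩, by rwa [dist_eq_norm]⟩
  refine ⟨r, hr, ?_, fun v hv hvr ↦ (hmem v hv hvr).2⟩
  rintro v ⟨hv, hvr⟩ w ⟨hw, hwr⟩ h
  exact hinjV₁ (hmem v hv hvr).1 (hmem w hw hwr).1 h

end Literature.Geometry.Riemannian

end
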